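import Summits.Parity.GeneralizedHardyLittlewood.Theses.LeeYangFibres
import Summits.Parity.GeneralizedHardyLittlewood.Theorems.LeeYangFibresCellParityLawDefs
import Summits.Parity.GeneralizedHardyLittlewood.Theorems.LeeYangFibresCellParityLawBase
import HarnessLib

/-!
# Route `LeeYangFibres`, crux `CellParityLaw` (stmt-Parity-14109), line `section-annihilator`:
# the `t = 1` layer of the crux, unconditionally

`LeeYangFibres.CellParityLaw` quantifies over the number of forms `t ≥ 1`. This file records, in the
crux's own currency (`ε N / log^t N`, amplitudes `θ` with `θ_∅ = 1`, `|θ_S| ≤ 2`), two facts that the line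
`section-annihilator` has already proved but never stated in this shape:

* `cellParityLawLayer_of_lawEffAt` — for every FIXED `t`, the line's effective law `LawEffAt t` (budget
  `N/(log^t N (log log N)^B)` for every `B`, `LeeYangFibresCellParityLawDefs`) implies the `t`-layer of the
  crux (budget `ε N/log^t N` for every `ε > 0`): take `B = 1` and `N ≥ exp(exp(1/ε))`. Pure bookkeeping, the
  same conversion as the landed `stub_reduction`.
* `cellParityLaw_layer_one` — the `t = 1` LAYER OF THE CRUX HOLDS UNCONDITIONALLY: one non-degenerate form
  `ψ(n) = a n + b` of size `≤ L` on a convex `K ⊆ [-N, N]`, i.e. the Landau–Alladi rough `Ω`-cells of one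
  progression segment follow the model `archFactor · singularProduct · A_j(N)/N` within `ε N/log N`
  (from the landed base `stub_base : LawEffAt 1`, p90699: Siegel–Walfisz for rough `Ω`-cells in progressions
  + Alladi's cell asymptotics with rate). This is the informal statement's "t = 1: Landau–Alladi cells of one
  progression segment (θ → 0, PNT level)".

The layers `t ≥ 2` are exactly where the conjectural atom (`SectionLevelAt`) and the kernel
(`EffectiveRoughCellLaw`) enter; see `LeeYangFibresCellParityLawConditional.lean`
(`cellParityLaw_layer_two_of`, `cellParityLaw_of_atom_of_kernel`).

The objects `cell`, `walsh`, `modelDensity` are VERBATIM the inlined finsets / Walsh factor of the route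
decl (they unfold definitionally), so each layer below is literally the body of `CellParityLaw` at that `t`.
-/

noncomputable section

open scoped BigOperators Classical
open Finset Literature.NumberTheory.Sieve

namespace Summit.Parity.GeneralizedHardyLittlewood.Cruxes.CellParityLaw.SectionAnnihilator

/-- **`stub_layerOfLawEffAt`** (registered bookkeeping sub-goal of stmt-Parity-14109, line
`section-annihilator`): for fixed `t`, the line's effective law `LawEffAt t` (budget
`N/(log^t N · (log log N)^B)`, every `B`) gives the body of `LeeYangFibres.CellParityLaw` at that `t`
(budget `ε N/log^t N`, every `ε > 0`): `B = 1` and `N ≥ exp(exp(1/ε))` make `1/log log N ≤ ε`. The same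
conversion as the landed `stub_reduction`, stated layer by layer. -/
theorem stub_layerOfLawEffAt : ∀ t : ℕ, LawEffAt t →
    ∀ (L u : ℕ), 2 ≤ u → ∀ ε : ℝ, 0 < ε → ∃ N₀ : ℕ, ∀ N : ℕ, N₀ ≤ N →
      ∀ Ψ : Fin t → AffLinForm 1, IsNondegenerateSystem Ψ → affLinSize Ψ N ≤ L →
      ∀ K : Set (Fin 1 → ℝ), Convex ℝ K → K ⊆ realBox 1 N →
      ∃ θ : Finset (Fin t) → ℝ, θ ∅ = 1 ∧ (∀ S, |θ S| ≤ 2) ∧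
        ∀ j : Fin t → ℕ, (∀ i, 1 ≤ j i ∧ j i ≤ u) →
          |(cell Ψ K N u j : ℝ) -
              walsh θ j * (archFactor Ψ K * singularProduct Ψ * ∏ i, modelDensity N u (j i))|
            ≤ ε * N / Real.log N ^ t := by
  intro t h L u hu ε hε
  obtain ⟨N₀, hN₀⟩ := h L u 1 hu
  refine ⟨max N₀ ⌈Real.exp (Real.exp (1 / ε))⌉₊, fun N hN Ψ hΨ hL K hK hKN => ?_⟩
  have hN₀N : N₀ ≤ N := le_trans (le_max_left _ _) hN
  have hN₁N : (⌈Real.exp (Real.exp (1 / ε))⌉₊ : ℝ) ≤ N := by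
    exact_mod_cast le_trans (le_max_right _ _) hN
  have hexpN : Real.exp (Real.exp (1 / ε)) ≤ (N : ℝ) := le_trans (Nat.le_ceil _) hN₁N
  have hlogN : Real.exp (1 / ε) ≤ Real.log N := by
    have := Real.log_le_log (Real.exp_pos _) hexpN
    rwa [Real.log_exp] at this
  have hloglogN : 1 / ε ≤ Real.log (Real.log N) := by
    have := Real.log_le_log (Real.exp_pos _) hlogN
    rwa [Real.log_exp] at this
  have hε' : 0 < 1 / ε := by positivity
  have hlogpos : 0 < Real.log N := lt_of_lt_of_le (Real.exp_pos _) hlogN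
  have hllpos : 0 < Real.log (Real.log N) := lt_of_lt_of_le hε' hloglogN
  obtain ⟨θ, hθ₀, hθS, hθ⟩ := hN₀ N hN₀N Ψ hΨ hL K hK hKN
  refine ⟨θ, hθ₀, hθS, fun j hj => le_trans (hθ j hj) ?_⟩
  have hpow : 0 < Real.log N ^ t := pow_pos hlogpos t
  have hinv : 1 / Real.log (Real.log N) ≤ ε := (one_div_le hllpos hε).mpr hloglogN
  have hNn : 0 ≤ (N : ℝ) / Real.log N ^ t := div_nonneg (Nat.cast_nonneg N) hpow.le
  calc (N : ℝ) / (Real.log N ^ t * Real.log (Real.log N) ^ 1)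
      = (N : ℝ) / Real.log N ^ t * (1 / Real.log (Real.log N)) := by
        rw [pow_one, div_mul_eq_div_div, div_eq_mul_one_div ((N : ℝ) / Real.log N ^ t)]
    _ ≤ (N : ℝ) / Real.log N ^ t * ε := mul_le_mul_of_nonneg_left hinv hNn
    _ = ε * N / Real.log N ^ t := by ring

/-- **A layer of the crux from the effective law at that layer** (curried corollary of
`stub_layerOfLawEffAt`). -/
theorem cellParityLawLayer_of_lawEffAt {t : ℕ} (h : LawEffAt t) :
    ∀ (L u : ℕ), 2 ≤ u → ∀ ε : ℝ, 0 < ε → ∃ N₀ : ℕ, ∀ N : ℕ, N₀ ≤ N →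
      ∀ Ψ : Fin t → AffLinForm 1, IsNondegenerateSystem Ψ → affLinSize Ψ N ≤ L →
      ∀ K : Set (Fin 1 → ℝ), Convex ℝ K → K ⊆ realBox 1 N →
      ∃ θ : Finset (Fin t) → ℝ, θ ∅ = 1 ∧ (∀ S, |θ S| ≤ 2) ∧
        ∀ j : Fin t → ℕ, (∀ i, 1 ≤ j i ∧ j i ≤ u) →
          |(cell Ψ K N u j : ℝ) -
              walsh θ j * (archFactor Ψ K * singularProduct Ψ * ∏ i, modelDensity N u (j i))|
            ≤ ε * N / Real.log N ^ t :=
  stub_layerOfLawEffAt t h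

/-- **The `t = 1` layer of `LeeYangFibres.CellParityLaw`, unconditionally.** For every `L`, `u ≥ 2`,
`ε > 0` and `N ≥ N₀(L, u, ε)`: every non-degenerate ONE-form system `ψ` of size `≤ L` and every convex
`K ⊆ [-N, N]` admit amplitudes `θ` (`θ_∅ = 1`, `|θ_S| ≤ 2`) with
`|C_j − W_θ(j) · archFactor · singularProduct · A_j(N)/N| ≤ ε N/log N` for all `j ∈ [1, u]` — the rough
`Ω`-cells of one progression segment follow the Landau–Alladi model at prime-number-theorem level. From the
landed base of the line (`stub_base : LawEffAt 1`). -/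
theorem cellParityLaw_layer_one :
    ∀ (L u : ℕ), 2 ≤ u → ∀ ε : ℝ, 0 < ε → ∃ N₀ : ℕ, ∀ N : ℕ, N₀ ≤ N →
      ∀ Ψ : Fin 1 → AffLinForm 1, IsNondegenerateSystem Ψ → affLinSize Ψ N ≤ L →
      ∀ K : Set (Fin 1 → ℝ), Convex ℝ K → K ⊆ realBox 1 N →
      ∃ θ : Finset (Fin 1) → ℝ, θ ∅ = 1 ∧ (∀ S, |θ S| ≤ 2) ∧
        ∀ j : Fin 1 → ℕ, (∀ i, 1 ≤ j i ∧ j i ≤ u) →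
          |(cell Ψ K N u j : ℝ) -
              walsh θ j * (archFactor Ψ K * singularProduct Ψ * ∏ i, modelDensity N u (j i))|
            ≤ ε * N / Real.log N ^ 1 :=
  cellParityLawLayer_of_lawEffAt stub_base

end Summit.Parity.GeneralizedHardyLittlewood.Cruxes.CellParityLaw.SectionAnnihilator

end
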